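import Literature.AlgebraicGeometry.AbelianSchemes.AbelianSchemeKOfLEtaleOfInvertibleOrder
import Literature.AlgebraicGeometry.AbelianSchemes.AbelianSchemeKOfLBaseChange
import Literature.AlgebraicGeometry.AbelianSchemes.ProjectiveAbelianSchemeAmpleClass
import Literature.AlgebraicGeometry.AbelianSchemes.DualPairHatCocycle
import Literature.AlgebraicGeometry.AbelianSchemes.DualPairOfGluedHatGlue
import Literature.AlgebraicGeometry.AbelianSchemes.DualPairOfGluedHatCompat
import Mathlib.AlgebraicGeometry.Noetherian
import HarnessLib

/-!
# Dual pairs glue along an open cover; the hodgecm letter `DualPairOfAmpleRigidified` glued over a locally Noetherian base from affine charts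
# ([BoschLutkebohmertRaynaud1990] §8.1 Prop. 4; [MumfordAV1970] §13 p. 125)

Layer `Literature/AlgebraicGeometry/AbelianSchemes`, namespace `Literature.AlgebraicGeometry.AbelianSchemes.MumfordDual`.  THEOREMS ONLY (★
`DualPairOfGluedHatGlue` + ★ `DualPairOfGluedHatCompat` + ★ `DualPairHatCocycle.exists_gluedHat`; no definition, no named fact, no instance, no notation, no
`sorry`).  Cell `hodgecm-mathlib` (D-0151), P6 «MOD programme», L4 DUALS road (LEAD F0P6-plan (g3) «M-55c»): the CONDITIONAL chart glue the `stub_GSPREAD`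
payer needs TODAY — it holds the socket `hD : DualPairOfAmpleRigidified` (P-line `Cruxes/HLiu418/Lines/F0_P6a_PELInputs.lean` v6g, letter v1.1, 9 binders
`R A hA L hL hε hΘ n hn hkill`) as a HYPOTHESIS and must produce `Dₜ : 𝒜ₜ.DualPair` over the NON-AFFINE stage base `𝓜.total ⊗ D(t)` from per-chart data
(★ O4 organs α–η: `LDeltaRigidifiedFibrewiseAmple`, `LocalizationRelativeRankOneSpread`, `RankOneAmpleClassSpreadStage`, `KOfLKilledOnFiniteAffineCharts`,
`RankOneLocalEmbeddingSpreadDedekind`, `LocalizationGenericGeometricPointFactor`, `RankOneRigidifyAlongUnitSection`).  The unconditional twin (the letter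
PROVED, road (A)) is ★-pending on the H1-DIM head; this file does not wait for it.

* **`nonempty_dualPair_of_openCover`** — (Z) dual pairs glue along any open cover of a locally Noetherian base (★ `exists_gluedHat` ∘ ★
  `nonempty_pullback_chartP_iso_of_gluedHat` ∘ ★ `nonempty_dualPair_of_gluedHat_of_compat` on the re-indexed cover `𝒰.ulift`; dual pairs are unique up to
  unique isomorphism).
* **`nonempty_dualPair_of_charts_of_letter`** — given the letter as hypothesis `hD` (its text verbatim, so `hD := stub_DUALS` type-checks by `δ`), an abelian
  scheme `A∕S` over a locally Noetherian `S` covered by affine Noetherian charts `cⱼ : Spec Rⱼ ↪ S` over each of which `A ×_S Spec Rⱼ` is projective and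
  carries the letter's data (`Lⱼ` of rank one rigidified along the unit section, fibrewise of an ample class, `nⱼ ∈ Rⱼ^×` killing `K(Lⱼ)`) has a dual pair.

HC_CM is proved only modulo the printed citations (2 remaining named inputs hLiu418 24832, h413 24833) until rung 0 closes; count-neutral capital.

## References
* [BoschLutkebohmertRaynaud1990] S. Bosch, W. Lütkebohmert, M. Raynaud, *Néron Models* (1990), §8.1 Prop. 4 (pp. 204–205) (gluing of `Pic` data).
* [MumfordAV1970] D. Mumford, *Abelian Varieties* (1970), §13 (p. 125) (the dual and the Poincaré bundle, uniqueness).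
* [MumfordFogartyKirwan1994] D. Mumford, J. Fogarty, F. Kirwan, *Geometric Invariant Theory*, 3rd ed. (1994), Ch. 6 §1 Cor. 6.8 (p. 118).
-/

set_option autoImplicit false

open CategoryTheory CategoryTheory.Limits AlgebraicGeometry MonoidalCategory CartesianMonoidalCategory
open scoped MonObj

noncomputable section

namespace Literature.AlgebraicGeometry.AbelianSchemes

namespace MumfordDual

open Literature.AlgebraicGeometry.Motives Literature.AlgebraicGeometry.Modules Literature.AlgebraicGeometry.Morphisms

/-- **(Z) DUAL PAIRS GLUE ALONG AN OPEN COVER OF THE BASE**: if `A ×_S Uᵢ` has a dual pair for every member of an open cover of the locally Noetherian `S`, then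
`A` has a dual pair (★ `exists_gluedHat` ∘ `nonempty_pullback_chartP_iso_of_gluedHat` ∘ `nonempty_dualPair_of_gluedHat_of_compat` on the re-indexed cover
`𝒰.ulift`: dual pairs are unique up to unique isomorphism, so the chart duals and their Poincaré bundles satisfy the cocycle condition).
[cite: BoschLutkebohmertRaynaud1990, §8.1 Prop. 4 (pp. 204–205)] [cite: MumfordAV1970, §13 p. 125] -/
theorem nonempty_dualPair_of_openCover {S : Scheme.{0}} [IsLocallyNoetherian S] (A : AbelianSchemeOver S) (𝒰 : S.OpenCover)
    (D : ∀ i, (A.baseChange (𝒰.f i)).DualPair) : Nonempty A.DualPair := by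
  obtain ⟨H, χ, hχ, hglue⟩ := A.exists_gluedHat 𝒰.ulift (fun x => D (𝒰.idx x))
  exact A.nonempty_dualPair_of_gluedHat_of_compat 𝒰.ulift (A.chartDual 𝒰.ulift fun x => D (𝒰.idx x)) H χ hχ
    (fun T b i j mi mj hmi hmj =>
      A.nonempty_pullback_chartP_iso_of_gluedHat 𝒰.ulift (fun x => D (𝒰.idx x)) H χ hχ hglue b i j mi mj hmi hmj)

/-- **THE LETTER `DualPairOfAmpleRigidified`, GLUED OVER A LOCALLY NOETHERIAN BASE FROM AFFINE CHARTS — CONDITIONAL FORM.**  Hypothesis `hD` is the text of the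
hodgecm letter (9 binders `R A hA L hL hε hΘ n hn hkill ⊢ Nonempty A.DualPair`; pass the socket `stub_DUALS`).  Given an abelian scheme `A∕S`, `S` locally
Noetherian, and affine Noetherian open charts `cⱼ : Spec Rⱼ ↪ S` covering `S` over each of which the base change `A ×_S Spec Rⱼ` is projective and carries a
rank-one `Lⱼ` rigidified along the unit section, fibrewise of the class of an ample divisor, with `K(Lⱼ)` killed by some `nⱼ ∈ Rⱼ^×`: `A` has a dual pair
(the letter on each chart, glued by `nonempty_dualPair_of_openCover`).  This is the shape the hodgecm chain meets at a stage `𝓜.total ⊗ D(t)` (charts and data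
by the ★ O4 organs). [cite: MumfordFogartyKirwan1994, Ch. 6 §1 Cor. 6.8 (p. 118)] [cite: BoschLutkebohmertRaynaud1990, §8.1 Prop. 4 (pp. 204–205)]
[cite: MumfordAV1970, §13 p. 125] -/
theorem nonempty_dualPair_of_charts_of_letter
    (hD : ∀ (R : Type) [CommRing R] [IsNoetherianRing R] (A : AbelianSchemeOver (Spec (.of R)))
      (_hA : IsProjective A.X.hom) (L : A.left.Modules) (hL : HasRank L 1),
      CechPic.pullback A.unitSection (detClass (HasRank.isFiniteLocallyFree' hL)) = 1 →
      (∀ ⦃Ω : Type⦄ [Field Ω] [IsAlgClosed Ω] (s : Spec (.of Ω) ⟶ Spec (.of R)),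
        ∃ Θ : CartierDivisor (A.fibre s).toAbelianVariety.X.left, Θ.IsAmple ∧
          CechPic.pullback (X := (A.fibre s).toAbelianVariety.X.left) (pullback.fst A.X.hom s)
            (detClass (HasRank.isFiniteLocallyFree' hL)) = Θ.cechClass) →
      ∀ (n : ℕ), IsUnit ((n : ℕ) : R) →
        (∀ (T : Over (Spec (.of R))) (u : T ⟶ A.X), A.MemKOfL L u → u ^ n = 1) →
        Nonempty A.DualPair)
    {S : Scheme.{0}} [IsLocallyNoetherian S] (A : AbelianSchemeOver S)
    {J : Type} (R : J → Type) [∀ j, CommRing (R j)] [∀ j, IsNoetherianRing (R j)] (c : ∀ j, Spec (.of (R j)) ⟶ S)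
    [∀ j, IsOpenImmersion (c j)] (hcov : ∀ s : S, ∃ j, s ∈ Set.range (c j))
    (hproj : ∀ j, IsProjective (A.baseChange (c j)).X.hom)
    (L : ∀ j, (A.baseChange (c j)).left.Modules) (hL : ∀ j, HasRank (L j) 1)
    (hε : ∀ j, CechPic.pullback (A.baseChange (c j)).unitSection (detClass (HasRank.isFiniteLocallyFree' (hL j))) = 1)
    (hΘ : ∀ j ⦃Ω : Type⦄ [Field Ω] [IsAlgClosed Ω] (t : Spec (.of Ω) ⟶ Spec (.of (R j))),
      ∃ Θ : CartierDivisor ((A.baseChange (c j)).fibre t).toAbelianVariety.X.left, Θ.IsAmple ∧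
        CechPic.pullback (X := ((A.baseChange (c j)).fibre t).toAbelianVariety.X.left) (pullback.fst (A.baseChange (c j)).X.hom t)
          (detClass (HasRank.isFiniteLocallyFree' (hL j))) = Θ.cechClass)
    (n : J → ℕ) (hn : ∀ j, IsUnit ((n j : ℕ) : R j))
    (hkill : ∀ j (T : Over (Spec (.of (R j)))) (u : T ⟶ (A.baseChange (c j)).X), (A.baseChange (c j)).MemKOfL (L j) u → u ^ n j = 1) :
    Nonempty A.DualPair := by
  classical
  let 𝒰 : Scheme.OpenCover.{0} S :=
    Scheme.Cover.mkOfCovers (P := @IsOpenImmersion) J (fun j => Spec (.of (R j))) c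
      (fun s => ⟨(hcov s).choose, (hcov s).choose_spec.choose, (hcov s).choose_spec.choose_spec⟩) inferInstance
  refine nonempty_dualPair_of_openCover A 𝒰 fun j => ?_
  exact (hD (R j) (A.baseChange (c j)) (hproj j) (L j) (hL j) (hε j) (hΘ j) (n j) (hn j) (hkill j)).some

end MumfordDual

end Literature.AlgebraicGeometry.AbelianSchemes

end
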